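import Literature.Analysis.FunctionSpaces.BMOCarlesonFeffermanStein
import Literature.Analysis.FunctionSpaces.BMOJohnNirenberg
import HarnessLib

/-!
# Fefferman–Stein `BMO ⇒ Carleson` for the heat extension: discharge of fact (B)

Topic `Analysis/FunctionSpaces`; Koch–Tataru cluster. `BMOCarleson.lean` decomposes Koch–Tataru's
Theorem 1 (`Literature.Analysis.FunctionSpaces.memBMOInv_iff_carleson_heat`) into the named facts
(A)–(E); fact **(B)** is the direction `BMO ⇒ Carleson` of the Fefferman–Stein characterisation of
`BMO` in the heat-kernel form of Koch–Tataru's Definition 1.1,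

  `∃ C = C(E), ∀ f ∈ BMO(E), sup_{x,R>0} R^{-d} ∫₀^{R²}∫_{B(x,R)} |∇e^{tΔ}f|² dy dt ≤ C ‖f‖²_*`

(`Literature.Analysis.FunctionSpaces.eCarlesonGradNorm_le_of_memBMO`). The source is Grafakos,
*Modern Fourier Analysis*, 3rd ed., Theorem 3.3.8 (b) (p. 178 of §3.3.2 "BMO Functions and
Carleson Measures"): for `b ∈ BMO(ℝⁿ)` and an integrable `Ψ` with mean value zero,
`|Ψ(x)| ≤ A(1+|x|)^{-n-δ}` (3.3.12) and `sup_ξ ∫₀^∞ |Ψ̂(tξ)|² dt/t ≤ B²` (3.3.14), the measure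
`dν = |Ψ_t ∗ b|² dx dt/t` is Carleson with norm `≤ C_{n,δ}(A+B)²‖b‖²_BMO`; applied to `Ψ = ∂ᵢΦ`,
`Φ(x) = π^{-n/2}e^{-|x|²}` (the remark after the theorem: mean zero plus gradient decay give
(3.3.13)–(3.3.14)), with `ρ = √(4t)` turning the cone measure into the caloric box integral.
Originally Fefferman–Stein, *Hᵖ spaces of several variables* (1972).

Both ingredients of the discharge are already proved in the tree:

* `Literature.Analysis.FunctionSpaces.BMOInv.eCarlesonGradNorm_le_of_memBMO_of_john_nirenberg :
    john_nirenberg → eCarlesonGradNorm_le_of_memBMO` (`BMOCarlesonFeffermanStein.lean`: Grafakos'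
  proof of Theorem 3.3.8 (b) transcribed to the caloric extension — near part by Plancherel and the
  energy inequality `∫₀^∞∫|∇e^{tΔ}g|² ≤ ½‖g‖₂²` together with the `L²` oscillation bound from
  John–Nirenberg (Grafakos Cor. 3.1.9), far part by the kernel decay `‖w‖^{d+1}‖∇K_t(w)‖ ≤ 2(d+2)!`
  and the tail estimate of Grafakos Prop. 3.1.5 (ii));
* `Literature.Analysis.FunctionSpaces.john_nirenberg_holds : john_nirenberg`
  (`BMOJohnNirenberg.lean`: John–Nirenberg 1961, Lemma 1', by a ball-based Calderón–Zygmund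
  iteration).

This file only composes them (the statement file `BMOCarleson.lean` cannot import its own proof
files, and `BMOCarlesonFeffermanStein.lean` does not import `BMOJohnNirenberg.lean`).

## Main statements (all proved)

* `Literature.Analysis.FunctionSpaces.eCarlesonGradNorm_le_of_memBMO_holds : eCarlesonGradNorm_le_of_memBMO`
  — fact (B) discharged, unconditionally.
* `Literature.Analysis.FunctionSpaces.MemBMO.eCarlesonGradNorm_lt_top` — the qualitative corollary
  `f ∈ BMO ⇒ sup_{x,R} R^{-d}∫₀^{R²}∫_{B(x,R)} |∇e^{tΔ}f|² < ∞`, i.e. `BMO` (mean oscillation) is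
  contained in Koch–Tataru's Carleson `BMO` of their Definition 1.1.

No new definitions.

## References

* L. Grafakos, *Modern Fourier Analysis*, 3rd ed., GTM 250, Springer (2014), Theorem 3.3.8 (b),
  §3.3.2, p. 178; Prop. 3.1.5, Cor. 3.1.9. [GrafakosMFA2014]
* C. Fefferman, E. M. Stein, *Hᵖ spaces of several variables*, Acta Math. 129 (1972), 137–193.
  [FeffermanStein1972]
* F. John, L. Nirenberg, *On functions of bounded mean oscillation*, Comm. Pure Appl. Math. 14
  (1961), 415–426, Lemma 1'. [JohnNirenberg1961]
* H. Koch, D. Tataru, *Well-posedness for the Navier–Stokes equations*, Adv. Math. 157 (2001),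
  22–35, Definition 1.1 and the remark following it. [KochTataruAdvMath2001]
-/

open scoped ENNReal

namespace Literature.Analysis.FunctionSpaces

universe u

variable {E : Type u} [NormedAddCommGroup E] [InnerProductSpace ℝ E] [FiniteDimensional ℝ E]
  [MeasurableSpace E] [BorelSpace E]

/-- **Fact (B) discharged — Fefferman–Stein, `BMO ⇒ Carleson`, heat-kernel form** (Grafakos,
*Modern Fourier Analysis*, 3rd ed., Theorem 3.3.8 (b) with `Ψ = ∂ᵢΦ`, `Φ = π^{-n/2}e^{-|x|²}`;
originally Fefferman–Stein 1972): there is a constant `C = C(E)` such that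
`sup_{x,R>0} R^{-d} ∫₀^{R²}∫_{B(x,R)} |∇e^{tΔ}f|² dy dt ≤ C ‖f‖²_*` for every `f ∈ BMO(E)`,
`d = dim E`. Obtained by feeding the John–Nirenberg inequality `john_nirenberg_holds`
(John–Nirenberg 1961, Lemma 1') into
`BMOInv.eCarlesonGradNorm_le_of_memBMO_of_john_nirenberg`. [cite: GrafakosMFA2014, Theorem 3.3.8 (b)] -/
theorem eCarlesonGradNorm_le_of_memBMO_holds : eCarlesonGradNorm_le_of_memBMO (E := E) :=
  BMOInv.eCarlesonGradNorm_le_of_memBMO_of_john_nirenberg john_nirenberg_holds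

open BMOInv in
/-- **`BMO ⊂` Koch–Tataru's Carleson `BMO`** (qualitative form of Grafakos, *Modern Fourier
Analysis*, 3rd ed., Theorem 3.3.8 (b); Koch–Tataru 2001, remark after Definition 1.1: their
Carleson-measure definition of `BMO` "is equivalent to the standard definition"): for
`f ∈ BMO(E)` the Carleson quantity `sup_{x,R>0} R^{-d}∫₀^{R²}∫_{B(x,R)} |∇e^{tΔ}f|² dy dt` is
finite. [cite: GrafakosMFA2014, Theorem 3.3.8 (b)] -/
theorem MemBMO.eCarlesonGradNorm_lt_top {f : E → ℝ} (hf : MemBMO f) :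
    eCarlesonGradNorm f < ∞ := by
  obtain ⟨C, hC⟩ := eCarlesonGradNorm_le_of_memBMO_holds (E := E)
  exact (hC hf).trans_lt (ENNReal.mul_lt_top (by simp) (ENNReal.pow_lt_top hf.eBMOSeminorm_lt_top))

end Literature.Analysis.FunctionSpaces
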